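import Summits.Ventures.PercRepro.C041TreeZoneNodeSets
import Summits.Ventures.PercRepro.C041TreeBridgeDefs
import Summits.Ventures.PercRepro.C041TreeStatesInvalid
import Summits.Ventures.PercRepro.C041ZoneOCubeCountCS

/-!
# ROW C-041 — THE DICTIONARY: every tree zone with one anchor is a zone of the abstract model, and the ZONE O-CUBE
and the one-anchor (CS) hold on it (p6, gen 29; C-041.md §15 (i), §19 (h), (k) — the last step of THEOREM (trees))

mine-3's rooted marked tree `t : TZ` is a zone of the graph model through mine-3's `C041TreeBridgeDefs` (`TZ.Pos`,
`TZ.Edge`, `TZ.M1`, `TZ.M2`, `TZ.toZone`, anchor `TZ.root`, and the state equivalence `TZ.stateEquiv : State t.Edge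
t.M1 t.M2 ≃ t.St`); on a node, that zone IS the NODE construction of `C041TreeZoneNode` (`TZ.toZone_node`) and the
state equivalence restricts child by child (`TZ.stateEquiv_node`).  THE DICTIONARY (`TZ.dict`, one structural
induction through the node lemmas of `C041TreeZoneNodeSets`): admissibility, relative admissibility, «the anchor is
deleted» (type 1), «deleted on side 2» (type 2) and «blue at `K`» (invalid) of the graph model are mine-3's `adm`,
`admR`, `rb1`, `rb2`, `¬ redK`.  Hence the four counts agree (`TZ.card_Fset`, `TZ.card_T1set`, `TZ.card_T2set`,
`TZ.card_Iset`), and with `zoneOCubeConj_single_iff` / `zoneCSConj_single_iff` (`C041ZoneOCubeCount(CS)`) and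
mine-3's `zoneOCube_counts` / `cs_counts`:

* **`TZ.zoneOCubeConj_toZone`** — mine-3's CONJECTURE (ZONE O-CUBE) holds on every tree zone with one anchor;
* **`TZ.zoneCSConj_toZone`** — CONJECTURE (ZONE CS) holds on every tree zone with one anchor.
-/

namespace PercRepro

namespace TreeClosure

open ZoneZ ZoneZ.ZoneData ZoneZ.TreeNode Finset

/-! ## The zone of a tree is the node construction -/

/-- The root of a node is `none`. -/
theorem TZ.root_node (p q d : ℕ) (cs : Fin d → TZ) : TZ.root (TZ.node p q d cs) = none := rfl

/-- **The zone of a node is the node construction** on the zones of its children. -/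
theorem TZ.toZone_node (p q d : ℕ) (cs : Fin d → TZ) :
    TZ.toZone (TZ.node p q d cs) = nodeZone (fun j => (cs j).toZone) (fun j => (cs j).root) p q := by
  rw [TZ.toZone]
  unfold nodeZone
  congr 1
  · funext x
    rcases x with ⟨j, _ | e⟩ <;> rfl
  · funext x
    rcases x with ⟨j, _ | e⟩ <;> rfl
  · funext x
    rcases x with i | ⟨j, m⟩ <;> rfl
  · funext x
    rcases x with i | ⟨j, m⟩ <;> rfl

/-- The state equivalence on a node: the root's marks, and per child the colour of its edge with the equivalence
applied to the restriction. -/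
theorem TZ.stateEquiv_node (p q d : ℕ) (cs : Fin d → TZ)
    (σ : State (NEdge fun j => (cs j).Edge) (NMark p fun j => (cs j).M1) (NMark q fun j => (cs j).M2)) :
    TZ.stateEquiv (TZ.node p q d cs) σ =
      (fun i => σ.2.1 (Sum.inl i), fun i => σ.2.2 (Sum.inl i),
        fun j => (σ.1 ⟨j, none⟩, TZ.stateEquiv (cs j) (restrict σ j))) := by
  rw [TZ.stateEquiv]
  rfl

/-! ## The dictionary -/

/-- The five correspondences between the zone of a tree and mine-3's model, at one state. -/
def TZ.Dict (t : TZ) (σ : State t.Edge t.M1 t.M2) : Prop :=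
  (t.toZone.adm σ ↔ t.adm (t.stateEquiv σ)) ∧ (t.toZone.admR t.root σ ↔ t.admR (t.stateEquiv σ)) ∧
    (t.root ∈ t.toZone.D σ ↔ t.rb1 (t.stateEquiv σ)) ∧ (t.root ∈ t.toZone.D2 σ ↔ t.rb2 (t.stateEquiv σ)) ∧
    (t.toZone.blueK {t.root} σ ↔ ¬ t.redK (t.stateEquiv σ))

/-- The dictionary on a node, from the dictionary on its children. -/
theorem TZ.dict_node (p q d : ℕ) (cs : Fin d → TZ)
    (ih : ∀ j (τ : State (cs j).Edge (cs j).M1 (cs j).M2), (cs j).Dict τ)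
    (σ : State (NEdge fun j => (cs j).Edge) (NMark p fun j => (cs j).M1) (NMark q fun j => (cs j).M2)) :
    (TZ.node p q d cs).Dict σ := by
  have ih1 : ∀ j τ, (cs j).toZone.adm τ ↔ (cs j).adm ((cs j).stateEquiv τ) := fun j τ => (ih j τ).1
  have ih2 : ∀ j τ, (cs j).toZone.admR (cs j).root τ ↔ (cs j).admR ((cs j).stateEquiv τ) :=
    fun j τ => (ih j τ).2.1
  have ih3 : ∀ j τ, (cs j).root ∈ (cs j).toZone.D τ ↔ (cs j).rb1 ((cs j).stateEquiv τ) :=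
    fun j τ => (ih j τ).2.2.1
  have ih4 : ∀ j τ, (cs j).root ∈ (cs j).toZone.D2 τ ↔ (cs j).rb2 ((cs j).stateEquiv τ) :=
    fun j τ => (ih j τ).2.2.2.1
  have ih5 : ∀ j τ, (cs j).toZone.blueK {(cs j).root} τ ↔ ¬ (cs j).redK ((cs j).stateEquiv τ) :=
    fun j τ => (ih j τ).2.2.2.2
  -- the graph side on the node
  have hR : (TZ.node p q d cs).toZone.admR (TZ.node p q d cs).root σ ↔
      (TZ.node p q d cs).admR (TZ.stateEquiv (TZ.node p q d cs) σ) := by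
    rw [TZ.stateEquiv_node, TZ.toZone_node, TZ.root_node]
    refine (admR_node_iff (fun j => (cs j).toZone) (fun j => (cs j).root) σ).trans ?_
    simp only [TZ.admR, ih2, ih3, ih4]
  have h1 : (TZ.node p q d cs).root ∈ (TZ.node p q d cs).toZone.D σ ↔
      (TZ.node p q d cs).rb1 (TZ.stateEquiv (TZ.node p q d cs) σ) := by
    rw [TZ.stateEquiv_node, TZ.toZone_node, TZ.root_node]
    refine (none_mem_D_iff (fun j => (cs j).toZone) (fun j => (cs j).root) σ).trans ?_
    simp only [TZ.rb1, ih3]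
  have h2 : (TZ.node p q d cs).root ∈ (TZ.node p q d cs).toZone.D2 σ ↔
      (TZ.node p q d cs).rb2 (TZ.stateEquiv (TZ.node p q d cs) σ) := by
    rw [TZ.stateEquiv_node, TZ.toZone_node, TZ.root_node]
    refine (none_mem_D2_iff (fun j => (cs j).toZone) (fun j => (cs j).root) σ).trans ?_
    simp only [TZ.rb2, ih4]
  have hK : (TZ.node p q d cs).toZone.blueK {(TZ.node p q d cs).root} σ ↔
      ¬ (TZ.node p q d cs).redK (TZ.stateEquiv (TZ.node p q d cs) σ) := by
    rw [TZ.stateEquiv_node, TZ.toZone_node, TZ.root_node]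
    refine (blueK_node_iff (fun j => (cs j).toZone) (fun j => (cs j).root) σ).trans ?_
    simp only [TZ.redK, ih5, not_or, not_exists, not_and]
  refine ⟨?_, hR, h1, h2, hK⟩
  rw [adm_iff_admR _ (TZ.node p q d cs).root, TZ.adm]
  exact and_congr hR (not_congr (and_congr h1 h2))

/-- **THE DICTIONARY** (C-041.md §15 (i)): on the zone of a tree with its root as the anchor, admissibility,
relative admissibility, «the anchor is deleted», «deleted on side `2`» and «blue at `K`» are mine-3's `adm`, `admR`,
`rb1`, `rb2` and `¬ redK` on the corresponding state of the model. -/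
theorem TZ.dict : ∀ (t : TZ) (σ : State t.Edge t.M1 t.M2), t.Dict σ
  | .node p q d cs, σ => TZ.dict_node p q d cs (fun j τ => TZ.dict (cs j) τ) σ

/-! ## The counts agree -/

/-- `#F` of the zone of a tree is mine-3's `cF`. -/
theorem TZ.card_Fset (t : TZ) : #(t.toZone.Fset t.root) = t.cF := by
  unfold TZ.cF
  refine Finset.card_equiv t.stateEquiv fun σ => ?_
  rw [mem_Fset, Finset.mem_filter]
  simp only [Finset.mem_univ, true_and]
  exact and_congr (t.dict σ).1 (and_congr (not_congr (t.dict σ).2.2.1) (not_congr (t.dict σ).2.2.2.1))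

/-- `#T₁` of the zone of a tree is mine-3's `cT1`. -/
theorem TZ.card_T1set (t : TZ) : #(t.toZone.T1set t.root) = t.cT1 := by
  unfold TZ.cT1
  refine Finset.card_equiv t.stateEquiv fun σ => ?_
  rw [mem_T1set, Finset.mem_filter]
  simp only [Finset.mem_univ, true_and]
  have e : t.toZone.adm σ ∧ t.root ∈ t.toZone.D σ ↔
      t.toZone.adm σ ∧ t.root ∈ t.toZone.D σ ∧ t.root ∉ t.toZone.D2 σ :=
    ⟨fun h => ⟨h.1, h.2, fun h2 => t.toZone.not_mem_D_of_mem_D2 t.root σ h.1 h2 h.2⟩, fun h => ⟨h.1, h.2.1⟩⟩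
  rw [e]
  exact and_congr (t.dict σ).1 (and_congr (t.dict σ).2.2.1 (not_congr (t.dict σ).2.2.2.1))

/-- `#T₂` of the zone of a tree is mine-3's `cT2`. -/
theorem TZ.card_T2set (t : TZ) : #(t.toZone.T2set t.root) = t.cT2 := by
  unfold TZ.cT2
  refine Finset.card_equiv t.stateEquiv fun σ => ?_
  rw [mem_T2set, Finset.mem_filter]
  simp only [Finset.mem_univ, true_and]
  have e : t.toZone.adm σ ∧ t.root ∈ t.toZone.D2 σ ↔
      t.toZone.adm σ ∧ t.root ∉ t.toZone.D σ ∧ t.root ∈ t.toZone.D2 σ :=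
    ⟨fun h => ⟨h.1, t.toZone.not_mem_D_of_mem_D2 t.root σ h.1 h.2, h.2⟩, fun h => ⟨h.1, h.2.2⟩⟩
  rw [e]
  exact and_congr (t.dict σ).1 (and_congr (not_congr (t.dict σ).2.2.1) (t.dict σ).2.2.2.1)

/-- `#I` of the zone of a tree is mine-3's `cI`. -/
theorem TZ.card_Iset (t : TZ) : #(t.toZone.Iset t.root) = t.cI := by
  unfold TZ.cI
  refine Finset.card_equiv t.stateEquiv fun σ => ?_
  rw [mem_Iset, Finset.mem_filter]
  simp only [Finset.mem_univ, true_and]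
  exact and_congr (t.dict σ).1 (t.dict σ).2.2.2.2

/-! ## THEOREM (trees) in the tree's own language -/

/-- **THE ZONE O-CUBE ON TREE ZONES** (C-041.md §15 (d), §19): mine-3's CONJECTURE (ZONE O-CUBE)
(`ZoneOCubeConj`, `C041ZoneOCubeDefs`) holds on the zone of every rooted marked tree with its root as the single
anchor and nothing protected. -/
theorem TZ.zoneOCubeConj_toZone (t : TZ) : t.toZone.ZoneOCubeConj {t.root} (∅ : Set t.Pos) := by
  rw [zoneOCubeConj_single_iff, t.card_Fset, t.card_T1set, t.card_T2set, t.card_Iset]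
  exact zoneOCube_counts t

/-- **THE ONE-ANCHOR (CS) ON TREE ZONES** (C-041.md §15 (b), §19): CONJECTURE (ZONE CS) (`ZoneCSConj`,
`C041ZoneOCubeCS`) holds on the zone of every rooted marked tree with its root as the single anchor. -/
theorem TZ.zoneCSConj_toZone (t : TZ) : t.toZone.ZoneCSConj {t.root} (∅ : Set t.Pos) := by
  rw [zoneCSConj_single_iff, t.card_Fset, t.card_T1set, t.card_T2set, t.card_Iset]
  exact cs_counts t

/-- The ZONE O-CUBE sum of the zone of a tree is nonnegative. -/
theorem TZ.zoneOCube_toZone_nonneg (t : TZ) : 0 ≤ t.toZone.zoneOCube {t.root} (∅ : Set t.Pos) :=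
  t.zoneOCubeConj_toZone

end TreeClosure

end PercRepro
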